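import Literature.Probability.FitznerVanDerHofstad2017.SrwCellSupsD10
import Literature.Probability.FitznerVanDerHofstad2017.SrwJSupTableD10ConeV3M3L2
import Literature.Probability.FitznerVanDerHofstad2017.SrwJSupTableD10E1
import HarnessLib

/-!
# The `IM` side of the `f₃` cell theorems at `d := 10`, read BY NAME from the landed `𝓙` / `I` literals

PACKET. b2b-lace packet, LEAN TYPING SEAT 1 gen 29 (unit `b2b-lace-lean1-g29`).  HOME/LEMMAS node D10-CELLIM (`lean1-g29:claim1`).

WHAT. `SrwCellSupsD10` (node D10-CELLSUP) wires the seven `T` / `U` / `K` binders of the `f₃` cell theorems of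
`F3BoundsCellReductionAlt` / `F3BoundsCellSplitAlt` at `d := 10` to the landed sup literals and leaves the `IM` side — one
`F3Bounds.CellDomAlt 10 α̲ ᾱ m l t` per read natural-row entry of an `𝒳`-cell, one `F3Bounds.OnDomAlt 10 α̲ ᾱ C m l t` per entry of a
cell over a cone `C` of `Q`, one `F3Bounds.OriginDomAlt 10 α̲ ᾱ m l t` per entry of the origin cell, and print's `m = −1` pair — as
hypotheses.  Every simple-random-walk quantity inside those hypotheses has by now a kernel literal BY NAME at `d := 10`:

* the `𝓙` cell sups `JSupD10.srwJ_calX_m<m>l<l>` / `srwJ_sup1_…` over `𝒳`, the cone sups `srwJ_cone_m<m>l<l>_v3 / _v21 / _v111` over the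
  three cones of `Q`, and the origin values `srwJ_origin_m<m>l<l>` (`SrwJSupTableD10`, `…Cones`, `…Derived`, `…ConeV3M3L2`, `…E1`);
* the certified class tables of `I_{n,l}(x; 10)` (`n ≤ 4`), packaged as the records `JSupD10.tab_v<cls> : JSupD10.ClsTab` (field `valid` =
  the landed enclosure theorem `ITableD10V<cls>.srwI_tab_encl_d10_<cls>`), read at any point of the class through `JSupD10.srwI_eq_of_absKey_eq`.

This module discharges the `IM` side from them.  §0: reads of `I_{n,l}` at the fifteen node points that occur (`0`, `e₁`, `2e₁`, `3e₁`, `4e₁`,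
`5e₁`, `e₁+e₂`, `2e₁+e₂`, `3e₁+e₂`, `4e₁+e₂`, `2e₁+2e₂`, `3e₁+2e₂`, `e₁+e₂+e₃`, `2e₁+e₂+e₃`, `3e₁+e₂+e₃`, `2e₁+2e₂+e₃`), each from the class record
by a kernel-decided key identity.  §1: ℚ-valued READ FUNCTIONS computed from the landed tables — the node maxima `iN2Q` ⊒ `srwINode2 10`,
`sN2Q` ⊒ `srwIShift2Node2 10` of the `𝒳`-cells, the cone reads `iCQ v`, `sCQ v` (value of `I` at the vertex; the cone majorant `S♯` of the shift
sum at the vertex, [NoBLE] Lemma 5.1) for the three cones `v`, the origin pair `i0Q`, `i2Q`, and the landed `𝓙` constants as tables `jXQ`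
(over `𝒳`), `jCQ v` (over the cone `v`), `jOQ` (at `0`) — every one with its soundness theorem proved from the landed theorems by name.  §2: the
`IM`-side CONSTRUCTORS at `d := 10` in both branches of [NoBLE] (3.64) — print's three entrywise inequalities, or the single corrected
inequality on the majorant `H1SlotD80.env 10 𝓙 I S α̲ ᾱ 1 2` of (3.61)–(3.62) — with ℚ-literal binders `(hq : readQ … ≤ q)` (decidable by
`decide +kernel` at any literal `q`, the shape of the `d = 11` record's `MeanFieldD11Rev10Cell11Nodes`) and the remaining arithmetic over
`((q : ℚ) : ℝ)`, `α̲`, `ᾱ`, `t`: `cellDomAlt_d10_of_printed / _of_env`, `onDomAlt_cone_d10_of_printed / _of_env`, `originDomAlt_d10_of_printed /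
_of_env`, and the `m = −1` pair in node form (`imNegOne_fst_node_d10`, `imNegOne_snd_node_d10`) and cone form (`imNegOne_fst_cone_d10`,
`imNegOne_snd_cone_d10`).  §2b: the same constructors ALL-ℚ — at a rational tuple `(α̲, ᾱ)` and a rational entry `q` each `IM`-side
hypothesis is one kernel decision (`envQ`, the ℚ mirror of the corrected majorant; `…_of_envQ`, `…_of_printedQ`, `imNegOne_…_d10Q`).  §3: the per-cone reading of a `Q`-cell glued back to the `∀ x, 3 ≤ Σ_j |x_j| → …` shape of the hypotheses `h0Q` /
`h1Q` of `nobleWeightedDiagramBoundAt_of_witness_srwTrueAlt_smallX` (`F3Bounds.boundHD75_srwTrueAlt_three_le_of_absCones` at `d := 10`).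

With `SrwCellSupsD10` §3 this leaves, for each of the six `f₃` slots of the small-`𝒳` route at `d := 10` (cells `(0,0)_Q`, `(1,0)_Q` per
cone, `(1,1)`, `(1,2)`, `(1,3)` over `𝒳`, `(1,6)` at `0`), only `1 ≤ α̲`, `1 ≤ ᾱ`, `a.WF`, the decided literal reads, the per-entry closing
inequalities and one `boundHD75 (Tables.cell IMc …) n l 0 a ≤ b` per (cell, cone) — all in the PARAMETERS `α̲`, `ᾱ`, `IMc`, `a`, `b`.

WHAT THIS FILE IS NOT. Pure simple-random-walk arithmetic at the parameter value `10` plus the cell algebra of [NoBLE] §3.3.5; no statement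
about percolation in any dimension; no certificate parameter, tuple or closing inequality of any analysis is fixed here, and no consumer
structure is instantiated.  What-if / input-certification lane: the record (CERT REV 14) and its frame are untouched.

References: [NoBLE] = Fitzner–van der Hofstad, *Generalized approach to the non-backtracking lace expansion*, PTRF 169 (2017) 1041–1119
(bib key `FitznerVanDerHofstad2016NoBLE`): §3.3.5 (3.58)–(3.64) pp. 1074–1076 (the `IM` tables and their domination), (3.30) p. 1070 (the shift
sum), (3.87) p. 1079 (the `f₃` cells), §5.1 (5.1) p. 1090 and Rem. 5.1 (the `I` tables and their symmetry), Lemma 5.1 p. 1093 (monotonicity in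
`|x_j|`, the per-cone reading).  [FvdH17] = Fitzner–van der Hofstad, EJP 22 (2017) no. 43, §2.5 (the Mathematica notebooks).
-/

noncomputable section

namespace Literature.Probability.FitznerVanDerHofstad2017

open Finset Real
open Literature.Barriers.CriticalPhenomena Literature.Probability.LatticeModels
open F3Bounds KTUD10 JSupD10 CellSupD10

namespace CellImD10

/-! ### §0  Reads of `I_{n,l}(·; 10)` at the node points, from the class records -/

/-- **A class-table read at any point of the class**: if `z` has the key of the record's point, `I_{n,l}(z; 10) ≤ hi n l` (`n ≤ 4`,
`l ≤ lmax`) — the record's landed enclosure transported by the signed-permutation invariance of `I`.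
[cite: FitznerVanDerHofstad2016NoBLE, (5.1) p. 1090, Rem. 5.1] -/
theorem srwI_le_hi (t : ClsTab) {z : Fin 10 → ℤ} (hz : absKey z = absKey t.pt) {n l : ℕ} (hn : n ≤ 4) (hl : l ≤ t.lmax) :
    srwI 10 n l z ≤ ((t.hi n l : ℚ) : ℝ) := by
  rw [srwI_eq_of_absKey_eq hz]
  exact (t.valid n hn l hl).2

/-- Key of `2e₁` = key of the point of `tab_v01`. [cite: FitznerVanDerHofstad2016NoBLE, Rem. 5.1 p. 1090] -/
theorem key_p2 : absKey (vecOfParts 10 [2]) = absKey tab_v01.pt := by decide +kernel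
/-- Key of `e₁+e₂` = key of the point of `tab_v2`. [cite: FitznerVanDerHofstad2016NoBLE, Rem. 5.1 p. 1090] -/
theorem key_c20 : absKey (classVec 10 2 0) = absKey tab_v2.pt := by decide +kernel
/-- Key of `e₁+e₂+e₃` = key of the point of `tab_v3`. [cite: FitznerVanDerHofstad2016NoBLE, Rem. 5.1 p. 1090] -/
theorem key_c30 : absKey (classVec 10 3 0) = absKey tab_v3.pt := by decide +kernel
/-- Key of `0` = key of the point of `tab_v0`. [cite: FitznerVanDerHofstad2016NoBLE, Rem. 5.1 p. 1090] -/
theorem key_p0 : absKey (0 : Fin 10 → ℤ) = absKey tab_v0.pt := by decide +kernel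
/-- Key of `e₁` = key of the point of `tab_v1`. [cite: FitznerVanDerHofstad2016NoBLE, Rem. 5.1 p. 1090] -/
theorem key_p1 : absKey (vecOfParts 10 [1]) = absKey tab_v1.pt := by decide +kernel
/-- Key of `3e₁` = key of the point of `tab_v001`. [cite: FitznerVanDerHofstad2016NoBLE, Rem. 5.1 p. 1090] -/
theorem key_p3 : absKey (vecOfParts 10 [3]) = absKey tab_v001.pt := by decide +kernel
/-- Key of `4e₁` = key of the point of `tab_v0001`. [cite: FitznerVanDerHofstad2016NoBLE, Rem. 5.1 p. 1090] -/
theorem key_p4 : absKey (vecOfParts 10 [4]) = absKey tab_v0001.pt := by decide +kernel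
/-- Key of `5e₁` = key of the point of `tab_v00001`. [cite: FitznerVanDerHofstad2016NoBLE, Rem. 5.1 p. 1090] -/
theorem key_p5 : absKey (vecOfParts 10 [5]) = absKey tab_v00001.pt := by decide +kernel
/-- Key of `2e₁+e₂` = key of the point of `tab_v11`. [cite: FitznerVanDerHofstad2016NoBLE, Rem. 5.1 p. 1090] -/
theorem key_p21 : absKey (vecOfParts 10 [2, 1]) = absKey tab_v11.pt := by decide +kernel
/-- Key of `3e₁+e₂` = key of the point of `tab_v101`. [cite: FitznerVanDerHofstad2016NoBLE, Rem. 5.1 p. 1090] -/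
theorem key_p31 : absKey (vecOfParts 10 [3, 1]) = absKey tab_v101.pt := by decide +kernel
/-- Key of `4e₁+e₂` = key of the point of `tab_v1001`. [cite: FitznerVanDerHofstad2016NoBLE, Rem. 5.1 p. 1090] -/
theorem key_p41 : absKey (vecOfParts 10 [4, 1]) = absKey tab_v1001.pt := by decide +kernel
/-- Key of `2e₁+2e₂` = key of the point of `tab_v02`. [cite: FitznerVanDerHofstad2016NoBLE, Rem. 5.1 p. 1090] -/
theorem key_p22 : absKey (vecOfParts 10 [2, 2]) = absKey tab_v02.pt := by decide +kernel
/-- Key of `3e₁+2e₂` = key of the point of `tab_v011`. [cite: FitznerVanDerHofstad2016NoBLE, Rem. 5.1 p. 1090] -/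
theorem key_p32 : absKey (vecOfParts 10 [3, 2]) = absKey tab_v011.pt := by decide +kernel
/-- Key of `2e₁+e₂+e₃` = key of the point of `tab_v21`. [cite: FitznerVanDerHofstad2016NoBLE, Rem. 5.1 p. 1090] -/
theorem key_p211 : absKey (vecOfParts 10 [2, 1, 1]) = absKey tab_v21.pt := by decide +kernel
/-- Key of `3e₁+e₂+e₃` = key of the point of `tab_v201`. [cite: FitznerVanDerHofstad2016NoBLE, Rem. 5.1 p. 1090] -/
theorem key_p311 : absKey (vecOfParts 10 [3, 1, 1]) = absKey tab_v201.pt := by decide +kernel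
/-- Key of `2e₁+2e₂+e₃` = key of the point of `tab_v12`. [cite: FitznerVanDerHofstad2016NoBLE, Rem. 5.1 p. 1090] -/
theorem key_p221 : absKey (vecOfParts 10 [2, 2, 1]) = absKey tab_v12.pt := by decide +kernel

/-! ### §1  ℚ-valued read functions computed from the landed tables, with soundness -/

/-- The node maximum of `I_{n,l}` over `𝒳` read from the tables: `max (hi[2e₁], hi[e₁+e₂])`. [cite: FitznerVanDerHofstad2016NoBLE, (5.1) p. 1090; Lemma 5.1 p. 1093] -/
def iN2Q (n l : ℕ) : ℚ := max (tab_v01.hi n l) (tab_v2.hi n l)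

/-- **`srwINode2 10 n l ≤ iN2Q n l`** (`n ≤ 4`, `l ≤ 22`). [cite: FitznerVanDerHofstad2016NoBLE, (5.1) p. 1090; Lemma 5.1 p. 1093] -/
theorem srwINode2_le_iN2Q {n l : ℕ} (hn : n ≤ 4) (hl : l ≤ 22) : srwINode2 10 n l ≤ ((iN2Q n l : ℚ) : ℝ) := by
  rw [iN2Q, Rat.cast_max]
  unfold srwINode2
  exact max_le_max (srwI_le_hi tab_v01 key_p2 hn (show l ≤ 34 by omega)) (srwI_le_hi tab_v2 key_c20 hn (show l ≤ 22 from hl))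

/-- The node majorant of the shift sum `S_{p,l}` over `𝒳` read from the tables:
`max (hi[0] + hi[4e₁] + 18·hi[2e₁+2e₂], 4·hi[e₁] + 16·hi[e₁+e₂])`. [cite: FitznerVanDerHofstad2016NoBLE, (3.30) p. 1070; (5.1) p. 1090; Lemma 5.1 p. 1093] -/
def sN2Q (p l : ℕ) : ℚ :=
  max (tab_v0.hi p l + tab_v0001.hi p l + 18 * tab_v02.hi p l) (4 * tab_v1.hi p l + 16 * tab_v2.hi p l)

/-- **`srwIShift2Node2 10 p l ≤ sN2Q p l`** (`p ≤ 4`, `l ≤ 22`). [cite: FitznerVanDerHofstad2016NoBLE, (3.30) p. 1070; (5.1) p. 1090; Lemma 5.1 p. 1093] -/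
theorem srwIShift2Node2_le_sN2Q {p l : ℕ} (hp : p ≤ 4) (hl : l ≤ 22) : srwIShift2Node2 10 p l ≤ ((sN2Q p l : ℚ) : ℝ) := by
  have h0 := srwI_le_hi tab_v0 key_p0 hp (show l ≤ 44 by omega)
  have h4 := srwI_le_hi tab_v0001 key_p4 hp (show l ≤ 34 by omega)
  have h22 := srwI_le_hi tab_v02 key_p22 hp (show l ≤ 34 by omega)
  have h1 := srwI_le_hi tab_v1 key_p1 hp (show l ≤ 22 from hl)
  have h2 := srwI_le_hi tab_v2 key_c20 hp (show l ≤ 22 from hl)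
  rw [sN2Q, Rat.cast_max]
  unfold srwIShift2Node2
  refine max_le_max ?_ ?_
  · refine le_of_le_of_eq (add_le_add (add_le_add h0 h4) (mul_le_mul_of_nonneg_left h22 (by norm_num))) ?_
    push_cast
    ring
  · refine le_of_le_of_eq (add_le_add (mul_le_mul_of_nonneg_left h1 (by norm_num)) (mul_le_mul_of_nonneg_left h2 (by norm_num))) ?_
    push_cast
    ring

/-- `I_{n,l}(0; 10)` read from the origin table. [cite: FitznerVanDerHofstad2016NoBLE, (5.1) p. 1090] -/
def i0Q (n l : ℕ) : ℚ := tab_v0.hi n l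

/-- **`I_{n,l}(0;10) ≤ i0Q n l`** (`n ≤ 4`, `l ≤ 44`). [cite: FitznerVanDerHofstad2016NoBLE, (5.1) p. 1090] -/
theorem srwI_origin_le_i0Q {n l : ℕ} (hn : n ≤ 4) (hl : l ≤ 44) : srwI 10 n l 0 ≤ ((i0Q n l : ℚ) : ℝ) :=
  srwI_le_hi tab_v0 key_p0 hn (show l ≤ 44 from hl)

/-- `I_{n,l}(2e₁; 10)` read from the table of the class of `2e₁`. [cite: FitznerVanDerHofstad2016NoBLE, (5.1) p. 1090] -/
def i2Q (n l : ℕ) : ℚ := tab_v01.hi n l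

/-- **`I_{n,l}(2e₁;10) ≤ i2Q n l`** (`n ≤ 4`, `l ≤ 34`). [cite: FitznerVanDerHofstad2016NoBLE, (5.1) p. 1090] -/
theorem srwI_two_le_i2Q {n l : ℕ} (hn : n ≤ 4) (hl : l ≤ 34) : srwI 10 n l (vecOfParts 10 [2]) ≤ ((i2Q n l : ℚ) : ℝ) :=
  srwI_le_hi tab_v01 key_p2 hn (show l ≤ 34 from hl)

/-- The three cones of `Q = {‖x‖₁ ≥ 3}` by their vertices `3e₁`, `2e₁+e₂`, `e₁+e₂+e₃`. [cite: FitznerVanDerHofstad2016NoBLE, §5.1 p. 1093] -/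
inductive Cn
  | v3
  | v21
  | v111
  deriving DecidableEq

/-- The vertex of the cone. [cite: FitznerVanDerHofstad2016NoBLE, §5.1 p. 1093] -/
def Cn.vec : Cn → (Fin 10 → ℤ)
  | .v3 => vecOfParts 10 [3]
  | .v21 => vecOfParts 10 [2, 1]
  | .v111 => vecOfParts 10 [1, 1, 1]

/-- The cone `{x : |x_j| ≥ v_j ∀ j}` of the vertex `v`. [cite: FitznerVanDerHofstad2016NoBLE, §5.1 p. 1093] -/
def Cn.cone (v : Cn) : Set (Fin 10 → ℤ) := absCone v.vec

/-- The vertex is coordinatewise non-negative. [cite: FitznerVanDerHofstad2016NoBLE, §5.1 p. 1093] -/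
theorem Cn.vec_nonneg (v : Cn) (j : Fin 10) : 0 ≤ v.vec j := by
  cases v <;> exact vecOfParts_nonneg 10 _ j

/-- Each cone lies in `Q`. [cite: FitznerVanDerHofstad2016NoBLE, §5.1 p. 1093] -/
theorem Cn.cone_subset_Q10 (v : Cn) : v.cone ⊆ Q10 := by
  cases v
  exacts [absCone_three_subset_Q10, absCone_two_one_subset_Q10, absCone_one_one_one_subset_Q10]

/-- `I_{n,l}` at the vertex of the cone, read from the class tables (`[3]`, `[2,1]`, `[1,1,1]`). [cite: FitznerVanDerHofstad2016NoBLE, (5.1) p. 1090; Lemma 5.1 p. 1093] -/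
def iCQ : Cn → ℕ → ℕ → ℚ
  | .v3, n, l => tab_v001.hi n l
  | .v21, n, l => tab_v11.hi n l
  | .v111, n, l => tab_v3.hi n l

/-- `I_{n,l}` at the vertex is at most `iCQ v n l` (`n ≤ 4`, `l ≤ 22`). [cite: FitznerVanDerHofstad2016NoBLE, (5.1) p. 1090, Rem. 5.1] -/
theorem srwI_vec_le_iCQ (v : Cn) {n l : ℕ} (hn : n ≤ 4) (hl : l ≤ 22) : srwI 10 n l v.vec ≤ ((iCQ v n l : ℚ) : ℝ) := by
  cases v
  · exact srwI_le_hi tab_v001 key_p3 hn (show l ≤ 22 from hl)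
  · exact srwI_le_hi tab_v11 key_p21 hn (show l ≤ 22 from hl)
  · simp only [Cn.vec]
    rw [← classVec_three_zero_eq_vecOfParts]
    exact srwI_le_hi tab_v3 key_c30 hn (show l ≤ 22 from hl)

/-- **`I_{n,l} ≤ iCQ v n l` on the cone `v`** (`1 ≤ n ≤ 4`, `l ≤ 22`; monotonicity in `|x_j|`, Lemma 5.1).
[cite: FitznerVanDerHofstad2016NoBLE, Lemma 5.1 p. 1093; (5.1) p. 1090; §5.1 p. 1093] -/
theorem srwI_cone_le_iCQ (v : Cn) {n l : ℕ} (hn1 : 1 ≤ n) (hn : n ≤ 4) (hl : l ≤ 22) :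
    ∀ x ∈ v.cone, srwI 10 n l x ≤ ((iCQ v n l : ℚ) : ℝ) :=
  srwI_le_on_absCone hn1 (by omega) l v.vec_nonneg (srwI_vec_le_iCQ v hn hl)

/-- The cone majorant `S♯_{p,l}(v)` of the shift sum at the vertex, in read form (Lemma 5.1 / (3.30)): `[5]+[1]+9([3,2]+[3])` for `3e₁`,
`[4,1]+[1]+([3,2]+[2])+8([2,2,1]+[2,1])` for `2e₁+e₂`, `3([3,1,1]+[1,1])+7([2,1,1]+[1,1,1])` for `e₁+e₂+e₃`.
[cite: FitznerVanDerHofstad2016NoBLE, (3.30) p. 1070; Lemma 5.1 p. 1093; (5.1) p. 1090] -/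
def sCQ : Cn → ℕ → ℕ → ℚ
  | .v3, p, l => tab_v00001.hi p l + tab_v1.hi p l + 9 * (tab_v011.hi p l + tab_v001.hi p l)
  | .v21, p, l => tab_v1001.hi p l + tab_v1.hi p l + (tab_v011.hi p l + tab_v01.hi p l) + 8 * (tab_v12.hi p l + tab_v11.hi p l)
  | .v111, p, l => 3 * (tab_v201.hi p l + tab_v2.hi p l) + 7 * (tab_v21.hi p l + tab_v3.hi p l)

/-- **The cone majorant at the vertex is at most `sCQ v p l`** (`1 ≤ p ≤ 4`, `l ≤ 22`).
[cite: FitznerVanDerHofstad2016NoBLE, (3.30) p. 1070; Lemma 5.1 p. 1093; (5.1) p. 1090] -/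
theorem shift2Cone_srwI_le_sCQ (v : Cn) {p l : ℕ} (hp1 : 1 ≤ p) (hp : p ≤ 4) (hl : l ≤ 22) :
    shift2Cone (srwI 10 p l) v.vec ≤ ((sCQ v p l : ℚ) : ℝ) := by
  have hl' : l ≤ 22 := hl
  cases v
  · have h := shift2Cone_vecOfParts_three_le_of (spInvariant_srwI p l) (by norm_num : 2 ≤ 10)
      (srwI_le_hi tab_v00001 key_p5 hp hl') (srwI_le_hi tab_v1 key_p1 hp hl')
      (srwI_le_hi tab_v011 key_p32 hp hl') (srwI_le_hi tab_v001 key_p3 hp hl')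
    refine h.trans_eq ?_
    simp only [sCQ]
    push_cast
    ring
  · have h := shift2Cone_vecOfParts_two_one_le_of (spInvariant_srwI p l) (by norm_num : 3 ≤ 10)
      (srwI_le_hi tab_v1001 key_p41 hp hl') (srwI_le_hi tab_v1 key_p1 hp hl')
      (srwI_le_hi tab_v011 key_p32 hp hl') (srwI_le_hi tab_v01 key_p2 hp (show l ≤ 34 by omega))
      (srwI_le_hi tab_v12 key_p221 hp hl') (srwI_le_hi tab_v11 key_p21 hp hl')
    refine h.trans_eq ?_
    simp only [sCQ]
    push_cast
    ring
  · simp only [Cn.vec]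
    rw [← classVec_three_zero_eq_vecOfParts]
    have h := shift2Cone_classVec_three_le_of (absMonotone_srwI hp1 (by omega) l) (spInvariant_srwI p l) (by norm_num : 3 ≤ 10)
      (srwI_le_hi tab_v201 key_p311 hp hl') (srwI_le_hi tab_v2 key_c20 hp hl')
      (srwI_le_hi tab_v21 key_p211 hp hl') (srwI_le_hi tab_v3 key_c30 hp hl')
    refine h.trans_eq ?_
    simp only [sCQ]
    push_cast
    ring

/-- **`S_{p,l} ≤ sCQ v p l` on the cone `v`** (`1 ≤ p ≤ 4`, `l ≤ 22`). [cite: FitznerVanDerHofstad2016NoBLE, (3.30) p. 1070; Lemma 5.1 p. 1093; §5.1 p. 1093] -/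
theorem srwIShift2_cone_le_sCQ (v : Cn) {p l : ℕ} (hp1 : 1 ≤ p) (hp : p ≤ 4) (hl : l ≤ 22) :
    ∀ x ∈ v.cone, srwIShift2 10 p l x ≤ ((sCQ v p l : ℚ) : ℝ) :=
  srwIShift2_le_on_absCone hp1 (by omega) l v.vec_nonneg (shift2Cone_srwI_le_sCQ v hp1 hp hl)

/-- The landed `𝓙` cell-sup constants over `𝒳` as a table: `jXQ m l ⊒ 𝓙_{m+2,l}` on `𝒳` (`m ∈ {0,1}`, `l ≤ 7`; the constants of
`JSupD10.srwJ_calX_m<m+2>l<l>` and, at `(3,6)`, `(3,7)`, of `srwJ_sup1_m3l<l>`). [cite: FitznerVanDerHofstad2016NoBLE, §3.3.5 p. 1079; (1.6.9) p. 1058; Lemma 5.1 p. 1093] -/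
def jXQ : ℕ → ℕ → ℚ
  | 0, 0 => dq 14453553 9
  | 0, 1 => dq 95162381 10
  | 0, 2 => dq 42186564 10
  | 0, 3 => dq 32981242 10
  | 0, 4 => dq 17546415 10
  | 0, 5 => dq 13882082 10
  | 0, 6 => dq 84882420 11
  | 0, 7 => dq 68392724 11
  | 1, 0 => dq 38600232 9
  | 1, 1 => dq 24409363 9
  | 1, 2 => dq 14893125 9
  | 1, 3 => dq 10674468 9
  | 1, 4 => dq 73763436 10
  | 1, 5 => dq 56217022 10
  | 1, 6 => dq 58182035 10
  | 1, 7 => dq 43419740 10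
  | _, _ => 0

/-- **`𝓙_{m+2,l}(x;10) ≤ jXQ m l` for every `x ∈ 𝒳`** (`m ≤ 1`, `l ≤ 7`), by name from the landed cell sups.
[cite: FitznerVanDerHofstad2016NoBLE, §3.3.5 p. 1079; (1.6.9) p. 1058; Lemma 5.1 p. 1093] -/
theorem srwJ_calX_le_jXQ {m l : ℕ} (hm : m ≤ 1) (hl : l ≤ 7) :
    ∀ x ∈ calX 10, srwJ 10 (m + 2) l x ≤ ((jXQ m l : ℚ) : ℝ) := by
  intro x hx
  have hx1 : (1 : ℤ) ≤ ∑ j, |x j| := le_trans (by norm_num) (two_le_sum_abs_of_mem_calX x hx)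
  interval_cases m <;> interval_cases l
  · exact srwJ_calX_m2l0 x hx
  · exact srwJ_calX_m2l1 x hx
  · exact srwJ_calX_m2l2 x hx
  · exact srwJ_calX_m2l3 x hx
  · exact srwJ_calX_m2l4 x hx
  · exact srwJ_calX_m2l5 x hx
  · exact srwJ_calX_m2l6 x hx
  · exact srwJ_calX_m2l7 x hx
  · exact srwJ_calX_m3l0 x hx
  · exact srwJ_calX_m3l1 x hx
  · exact srwJ_calX_m3l2 x hx
  · exact srwJ_calX_m3l3 x hx
  · exact srwJ_calX_m3l4 x hx
  · exact srwJ_calX_m3l5 x hx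
  · exact srwJ_sup1_m3l6 x hx1
  · exact srwJ_sup1_m3l7 x hx1

/-- Column range of the landed cone sups: `jCQ v m l` is a landed constant iff `l ≤ Cn.lJ v m`. [cite: FitznerVanDerHofstad2016NoBLE, §5.1 p. 1093] -/
def Cn.lJ : Cn → ℕ → ℕ
  | .v3, 0 => 6
  | .v3, 1 => 2
  | .v21, 0 => 7
  | .v21, 1 => 2
  | .v111, 0 => 7
  | .v111, 1 => 3
  | _, _ => 0

/-- The landed `𝓙` cone-sup constants: `jCQ v m l ⊒ 𝓙_{m+2,l}` on the cone `v` (the constants of `JSupD10.srwJ_cone_m<m+2>l<l>_v<v>`).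
[cite: FitznerVanDerHofstad2016NoBLE, §5.1 p. 1093; (1.6.9) p. 1058; Lemma 5.1 p. 1093] -/
def jCQ : Cn → ℕ → ℕ → ℚ
  | .v3, 0, 0 => dq 21820997 10
  | .v3, 0, 1 => dq 13461582 10
  | .v3, 0, 2 => dq 78493458 11
  | .v3, 0, 3 => dq 49842880 11
  | .v3, 0, 4 => dq 36164084 11
  | .v3, 0, 5 => dq 24957071 11
  | .v3, 0, 6 => dq 19690591 11
  | .v3, 1, 0 => dq 67140569 10
  | .v3, 1, 1 => dq 45319573 10
  | .v3, 1, 2 => dq 31857991 10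
  | .v21, 0, 0 => dq 34670992 10
  | .v21, 0, 1 => dq 24035630 10
  | .v21, 0, 2 => dq 15748517 10
  | .v21, 0, 3 => dq 98096511 11
  | .v21, 0, 4 => dq 74690344 11
  | .v21, 0, 5 => dq 49766659 11
  | .v21, 0, 6 => dq 39887958 11
  | .v21, 0, 7 => dq 28491739 11
  | .v21, 1, 0 => dq 11940204 9
  | .v21, 1, 1 => dq 84731041 10
  | .v21, 1, 2 => dq 60695412 10
  | .v111, 0, 0 => dq 40189417 10
  | .v111, 0, 1 => dq 32860677 10
  | .v111, 0, 2 => dq 24442819 10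
  | .v111, 0, 3 => dq 14935843 10
  | .v111, 0, 4 => dq 11839748 10
  | .v111, 0, 5 => dq 76545349 11
  | .v111, 0, 6 => dq 62052041 11
  | .v111, 0, 7 => dq 43042552 11
  | .v111, 1, 0 => dq 16412222 9
  | .v111, 1, 1 => dq 12393280 9
  | .v111, 1, 2 => dq 91072119 10
  | .v111, 1, 3 => dq 66629300 10
  | _, _, _ => 0

/-- **`𝓙_{m+2,l}(x;10) ≤ jCQ v m l` on the cone `v`** (`m ≤ 1`, `l ≤ Cn.lJ v m`), by name from the landed cone sups.
[cite: FitznerVanDerHofstad2016NoBLE, §5.1 p. 1093; (1.6.9) p. 1058; Lemma 5.1 p. 1093] -/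
theorem srwJ_cone_le_jCQ (v : Cn) {m l : ℕ} (hm : m ≤ 1) (hl : l ≤ v.lJ m) :
    ∀ x ∈ v.cone, srwJ 10 (m + 2) l x ≤ ((jCQ v m l : ℚ) : ℝ) := by
  intro x hx
  cases v <;> interval_cases m <;> simp only [Cn.lJ] at hl <;> interval_cases l
  · exact srwJ_cone_m2l0_v3 x hx
  · exact srwJ_cone_m2l1_v3 x hx
  · exact srwJ_cone_m2l2_v3 x hx
  · exact srwJ_cone_m2l3_v3 x hx
  · exact srwJ_cone_m2l4_v3 x hx
  · exact srwJ_cone_m2l5_v3 x hx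
  · exact srwJ_cone_m2l6_v3 x hx
  · exact srwJ_cone_m3l0_v3 x hx
  · exact srwJ_cone_m3l1_v3 x hx
  · exact srwJ_cone_m3l2_v3 x hx
  · exact srwJ_cone_m2l0_v21 x hx
  · exact srwJ_cone_m2l1_v21 x hx
  · exact srwJ_cone_m2l2_v21 x hx
  · exact srwJ_cone_m2l3_v21 x hx
  · exact srwJ_cone_m2l4_v21 x hx
  · exact srwJ_cone_m2l5_v21 x hx
  · exact srwJ_cone_m2l6_v21 x hx
  · exact srwJ_cone_m2l7_v21 x hx
  · exact srwJ_cone_m3l0_v21 x hx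
  · exact srwJ_cone_m3l1_v21 x hx
  · exact srwJ_cone_m3l2_v21 x hx
  · exact srwJ_cone_m2l0_v111 x hx
  · exact srwJ_cone_m2l1_v111 x hx
  · exact srwJ_cone_m2l2_v111 x hx
  · exact srwJ_cone_m2l3_v111 x hx
  · exact srwJ_cone_m2l4_v111 x hx
  · exact srwJ_cone_m2l5_v111 x hx
  · exact srwJ_cone_m2l6_v111 x hx
  · exact srwJ_cone_m2l7_v111 x hx
  · exact srwJ_cone_m3l0_v111 x hx
  · exact srwJ_cone_m3l1_v111 x hx
  · exact srwJ_cone_m3l2_v111 x hx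
  · exact srwJ_cone_m3l3_v111 x hx

/-- The landed `𝓙` origin constants: `jOQ m l ⊒ 𝓙_{m+2,l}(0;10)` (`m = 0`: `l ≤ 7`; `m = 1`: `l ≤ 8`; the constants of
`JSupD10.srwJ_origin_m<m+2>l<l>`). [cite: FitznerVanDerHofstad2016NoBLE, (3.30) p. 1070; (1.6.9) p. 1058] -/
def jOQ : ℕ → ℕ → ℚ
  | 0, 0 => dq 40622260 30
  | 0, 1 => dq 59543748 9
  | 0, 2 => dq 13494460 9
  | 0, 3 => dq 11852136 9
  | 0, 4 => dq 46167757 10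
  | 0, 5 => dq 36633796 10
  | 0, 6 => dq 18669476 10
  | 0, 7 => dq 14762295 10
  | 1, 0 => dq 10085565 8
  | 1, 1 => dq 10085565 8
  | 1, 2 => dq 41311902 9
  | 1, 3 => dq 27817442 9
  | 1, 4 => dq 15965307 9
  | 1, 5 => dq 11348531 9
  | 1, 6 => dq 76851510 10
  | 1, 7 => dq 58182035 10
  | 1, 8 => dq 43419740 10
  | _, _ => 0

/-- Column range of the landed origin constants used here. [cite: FitznerVanDerHofstad2016NoBLE, (3.30) p. 1070] -/
def lO : ℕ → ℕ
  | 0 => 7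
  | 1 => 8
  | _ => 0

/-- **`𝓙_{m+2,l}(0;10) ≤ jOQ m l`** (`m ≤ 1`, `l ≤ lO m`), by name from the landed origin reads.
[cite: FitznerVanDerHofstad2016NoBLE, (3.30) p. 1070; (1.6.9) p. 1058] -/
theorem srwJ_origin_le_jOQ {m l : ℕ} (hm : m ≤ 1) (hl : l ≤ lO m) : srwJ 10 (m + 2) l 0 ≤ ((jOQ m l : ℚ) : ℝ) := by
  interval_cases m <;> simp only [lO] at hl <;> interval_cases l
  · exact srwJ_origin_m2l0
  · exact srwJ_origin_m2l1
  · exact srwJ_origin_m2l2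
  · exact srwJ_origin_m2l3
  · exact srwJ_origin_m2l4
  · exact srwJ_origin_m2l5
  · exact srwJ_origin_m2l6
  · exact srwJ_origin_m2l7
  · exact srwJ_origin_m3l0
  · exact srwJ_origin_m3l1
  · exact srwJ_origin_m3l2
  · exact srwJ_origin_m3l3
  · exact srwJ_origin_m3l4
  · exact srwJ_origin_m3l5
  · exact srwJ_origin_m3l6
  · exact srwJ_origin_m3l7
  · exact srwJ_origin_m3l8

/-! ### §2  The `IM`-side constructors at `d := 10` with ℚ-literal binders -/

section Constructors

variable {afmin afmax t : ℝ}

/-- Monotonicity of the cast `ℚ → ℝ` (private plumbing). [folklore] -/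
private theorem castle {f q : ℚ} (h : f ≤ q) : ((f : ℚ) : ℝ) ≤ ((q : ℚ) : ℝ) := Rat.cast_le.2 h

/-- **`CellDomAlt 10 α̲ ᾱ m l t`, print's branch** ((3.64) first alternative): from literal reads `jXQ m l ≤ qJ`, `iN2Q (m+3) l ≤ qI`,
`sN2Q (m+3) l ≤ qS` (`m ≤ 1`, `l ≤ 7`) and the three entrywise inequalities `qJ ≤ t`, `qI ≤ 10·α̲·t`, `(ᾱ−1)·qS ≤ 2·10²·t` (`ᾱ ≥ 1`).
[cite: FitznerVanDerHofstad2016NoBLE, §3.3.5 (3.64) p. 1076, p. 1079; Lemma 5.1 p. 1093] -/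
theorem cellDomAlt_d10_of_printed (hᾱ : 1 ≤ afmax) {m l : ℕ} (hm : m ≤ 1) (hl : l ≤ 7) {qJ qI qS : ℚ}
    (hJ : jXQ m l ≤ qJ) (hI : iN2Q (m + 3) l ≤ qI) (hS : sN2Q (m + 3) l ≤ qS)
    (h1 : ((qJ : ℚ) : ℝ) ≤ t) (h2 : ((qI : ℚ) : ℝ) ≤ ((10 : ℕ) : ℝ) * afmin * t)
    (h3 : (afmax - 1) * ((qS : ℚ) : ℝ) ≤ 2 * ((10 : ℕ) : ℝ) ^ 2 * t) :
    CellDomAlt 10 afmin afmax m l t :=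
  cellDomAlt_of_printed (fun x hx => ((srwJ_calX_le_jXQ hm hl x hx).trans (castle hJ)).trans h1)
    (((srwINode2_le_iN2Q (by omega) (by omega)).trans (castle hI)).trans h2)
    ((mul_le_mul_of_nonneg_left ((srwIShift2Node2_le_sN2Q (by omega) (by omega)).trans (castle hS)) (by linarith)).trans h3)

/-- **`CellDomAlt 10 α̲ ᾱ m l t`, corrected branch** ((3.64) second alternative, with the corrected majorant (3.61)–(3.62)): from the same
three literal reads and the single inequality `H1SlotD80.env 10 qJ qI qS α̲ ᾱ 1 2 ≤ t` (`0 < α̲`, `1 ≤ ᾱ`).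
[cite: FitznerVanDerHofstad2016NoBLE, §3.3.5 (3.61)–(3.62), (3.64) p. 1076, p. 1079; Lemma 5.1 p. 1093] -/
theorem cellDomAlt_d10_of_env (hα : 0 < afmin) (hᾱ : 1 ≤ afmax) {m l : ℕ} (hm : m ≤ 1) (hl : l ≤ 7) {qJ qI qS : ℚ}
    (hJ : jXQ m l ≤ qJ) (hI : iN2Q (m + 3) l ≤ qI) (hS : sN2Q (m + 3) l ≤ qS)
    (h : H1SlotD80.env ((10 : ℕ) : ℝ) ((qJ : ℚ) : ℝ) ((qI : ℚ) : ℝ) ((qS : ℚ) : ℝ) afmin afmax 1 2 ≤ t) :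
    CellDomAlt 10 afmin afmax m l t :=
  cellDomAlt_of_env_le (fun x hx => (srwJ_calX_le_jXQ hm hl x hx).trans (castle hJ))
    ((H1SlotD80.env_mono 1 2 (by norm_num) hα hᾱ le_rfl ((srwINode2_le_iN2Q (by omega) (by omega)).trans (castle hI))
      ((srwIShift2Node2_le_sN2Q (by omega) (by omega)).trans (castle hS))).trans h)

/-- **Print's `m = −1` pair over `𝒳`, first member, node form**: `srwINode2 10 1 (l+1) + srwIShift2Node2 10 2 l / (2·10²·α̲) ≤ t` from the
reads `iN2Q 1 (l+1) ≤ qA`, `sN2Q 2 l ≤ qB` and `qA + qB/(2·10²·α̲) ≤ t` (`0 < α̲`, `l ≤ 21`).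
[cite: FitznerVanDerHofstad2016NoBLE, §3.3.5 (3.58) p. 1074, p. 1079; Lemma 5.1 p. 1093] -/
theorem imNegOne_fst_node_d10 (hα : 0 < afmin) {l : ℕ} (hl : l ≤ 21) {qA qB : ℚ} (hA : iN2Q 1 (l + 1) ≤ qA) (hB : sN2Q 2 l ≤ qB)
    (h : ((qA : ℚ) : ℝ) + ((qB : ℚ) : ℝ) / (2 * ((10 : ℕ) : ℝ) ^ 2 * afmin) ≤ t) :
    srwINode2 10 1 (l + 1) + srwIShift2Node2 10 2 l / (2 * ((10 : ℕ) : ℝ) ^ 2 * afmin) ≤ t := by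
  have hpos : 0 < 2 * ((10 : ℕ) : ℝ) ^ 2 * afmin := by positivity
  exact (add_le_add ((srwINode2_le_iN2Q (by norm_num) (by omega)).trans (castle hA))
    (div_le_div_of_nonneg_right ((srwIShift2Node2_le_sN2Q (by norm_num) (by omega)).trans (castle hB)) hpos.le)).trans h

/-- **Print's `m = −1` pair over `𝒳`, second member, node form**: `srwINode2 10 2 l ≤ 10·α̲·t` from `iN2Q 2 l ≤ qI` and `qI ≤ 10·α̲·t`
(`l ≤ 22`). [cite: FitznerVanDerHofstad2016NoBLE, §3.3.5 (3.58) p. 1074, p. 1079; Lemma 5.1 p. 1093] -/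
theorem imNegOne_snd_node_d10 {l : ℕ} (hl : l ≤ 22) {qI : ℚ} (hI : iN2Q 2 l ≤ qI)
    (h : ((qI : ℚ) : ℝ) ≤ ((10 : ℕ) : ℝ) * afmin * t) : srwINode2 10 2 l ≤ ((10 : ℕ) : ℝ) * afmin * t :=
  ((srwINode2_le_iN2Q (by norm_num) hl).trans (castle hI)).trans h

/-- **`OnDomAlt 10 α̲ ᾱ (cone v) m l t`, print's branch**: from the literal reads `jCQ v m l ≤ qJ`, `iCQ v (m+3) l ≤ qI`, `sCQ v (m+3) l ≤ qS`
(`m ≤ 1`, `l ≤ Cn.lJ v m`) and `qJ ≤ t`, `qI ≤ 10·α̲·t`, `(ᾱ−1)·qS ≤ 2·10²·t` (`ᾱ ≥ 1`).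
[cite: FitznerVanDerHofstad2016NoBLE, §3.3.5 (3.64) p. 1076, p. 1079; §5.1 p. 1093; Lemma 5.1 p. 1093] -/
theorem onDomAlt_cone_d10_of_printed (v : Cn) (hᾱ : 1 ≤ afmax) {m l : ℕ} (hm : m ≤ 1) (hl : l ≤ v.lJ m) {qJ qI qS : ℚ}
    (hJ : jCQ v m l ≤ qJ) (hI : iCQ v (m + 3) l ≤ qI) (hS : sCQ v (m + 3) l ≤ qS)
    (h1 : ((qJ : ℚ) : ℝ) ≤ t) (h2 : ((qI : ℚ) : ℝ) ≤ ((10 : ℕ) : ℝ) * afmin * t)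
    (h3 : (afmax - 1) * ((qS : ℚ) : ℝ) ≤ 2 * ((10 : ℕ) : ℝ) ^ 2 * t) :
    OnDomAlt 10 afmin afmax v.cone m l t := by
  have hl22 : l ≤ 22 := by
    revert hl
    cases v <;> interval_cases m <;> simp only [Cn.lJ] <;> omega
  refine onDomAlt_of_printed (fun x hx => ((srwJ_cone_le_jCQ v hm hl x hx).trans (castle hJ)).trans h1)
    (fun x hx => ((srwI_cone_le_iCQ v (by omega) (by omega) hl22 x hx).trans (castle hI)).trans h2) fun x hx => ?_
  exact (mul_le_mul_of_nonneg_left ((srwIShift2_cone_le_sCQ v (by omega) (by omega) hl22 x hx).trans (castle hS))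
    (by linarith)).trans h3

/-- **`OnDomAlt 10 α̲ ᾱ (cone v) m l t`, corrected branch**: from the same reads and `H1SlotD80.env 10 qJ qI qS α̲ ᾱ 1 2 ≤ t`.
[cite: FitznerVanDerHofstad2016NoBLE, §3.3.5 (3.61)–(3.62), (3.64) p. 1076, p. 1079; §5.1 p. 1093; Lemma 5.1 p. 1093] -/
theorem onDomAlt_cone_d10_of_env (v : Cn) {m l : ℕ} (hm : m ≤ 1) (hl : l ≤ v.lJ m) {qJ qI qS : ℚ}
    (hJ : jCQ v m l ≤ qJ) (hI : iCQ v (m + 3) l ≤ qI) (hS : sCQ v (m + 3) l ≤ qS)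
    (h : H1SlotD80.env ((10 : ℕ) : ℝ) ((qJ : ℚ) : ℝ) ((qI : ℚ) : ℝ) ((qS : ℚ) : ℝ) afmin afmax 1 2 ≤ t) :
    OnDomAlt 10 afmin afmax v.cone m l t := by
  have hl22 : l ≤ 22 := by
    revert hl
    cases v <;> interval_cases m <;> simp only [Cn.lJ] <;> omega
  exact onDomAlt_of_env_le (fun x hx => (srwJ_cone_le_jCQ v hm hl x hx).trans (castle hJ))
    (fun x hx => (srwI_cone_le_iCQ v (by omega) (by omega) hl22 x hx).trans (castle hI))
    (fun x hx => (srwIShift2_cone_le_sCQ v (by omega) (by omega) hl22 x hx).trans (castle hS)) h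

/-- **Print's `m = −1` pair on the cone `v`, first member**: `I_{1,l+1}(x) + S_{2,l}(x)/(2·10²·α̲) ≤ t` for all `x` in the cone, from the
vertex reads `iCQ v 1 (l+1) ≤ qA`, `sCQ v 2 l ≤ qB` and `qA + qB/(2·10²·α̲) ≤ t` (`0 < α̲`, `l ≤ 21`).
[cite: FitznerVanDerHofstad2016NoBLE, §3.3.5 (3.58) p. 1074, p. 1079; §5.1 p. 1093; Lemma 5.1 p. 1093] -/
theorem imNegOne_fst_cone_d10 (v : Cn) (hα : 0 < afmin) {l : ℕ} (hl : l ≤ 21) {qA qB : ℚ}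
    (hA : iCQ v 1 (l + 1) ≤ qA) (hB : sCQ v 2 l ≤ qB)
    (h : ((qA : ℚ) : ℝ) + ((qB : ℚ) : ℝ) / (2 * ((10 : ℕ) : ℝ) ^ 2 * afmin) ≤ t) :
    ∀ x ∈ v.cone, srwI 10 1 (l + 1) x + srwIShift2 10 2 l x / (2 * ((10 : ℕ) : ℝ) ^ 2 * afmin) ≤ t :=
  imNegOne_fst_le_on_absCone (by norm_num) l v.vec_nonneg hα ((srwI_vec_le_iCQ v (by norm_num) (by omega)).trans (castle hA))
    ((shift2Cone_srwI_le_sCQ v (by norm_num) (by norm_num) (by omega)).trans (castle hB)) h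

/-- **Print's `m = −1` pair on the cone `v`, second member**: `I_{2,l}(x) ≤ 10·α̲·t` on the cone from `iCQ v 2 l ≤ qI`, `qI ≤ 10·α̲·t`
(`l ≤ 22`). [cite: FitznerVanDerHofstad2016NoBLE, §3.3.5 (3.58) p. 1074, p. 1079; §5.1 p. 1093; Lemma 5.1 p. 1093] -/
theorem imNegOne_snd_cone_d10 (v : Cn) {l : ℕ} (hl : l ≤ 22) {qI : ℚ} (hI : iCQ v 2 l ≤ qI)
    (h : ((qI : ℚ) : ℝ) ≤ ((10 : ℕ) : ℝ) * afmin * t) : ∀ x ∈ v.cone, srwI 10 2 l x ≤ ((10 : ℕ) : ℝ) * afmin * t :=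
  fun x hx => ((srwI_cone_le_iCQ v (by norm_num) (by norm_num) hl x hx).trans (castle hI)).trans h

/-- **`OriginDomAlt 10 α̲ ᾱ m l t`, print's branch**: from the reads `jOQ m l ≤ qJ`, `i0Q (m+3) l ≤ qI`, `i2Q (m+3) l ≤ qI2` (`m ≤ 1`,
`l ≤ lO m`) and `qJ ≤ t`, `qI ≤ 10·α̲·t`, `(ᾱ−1)·(2·10·qI2) ≤ 2·10²·t` (`ᾱ ≥ 1`; `S_{p,l}(0) = 2d·I_{p,l}(2e₁)`).
[cite: FitznerVanDerHofstad2016NoBLE, §3.3.5 (3.64) p. 1076; (3.30) p. 1070; (5.1) p. 1090] -/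
theorem originDomAlt_d10_of_printed (hᾱ : 1 ≤ afmax) {m l : ℕ} (hm : m ≤ 1) (hl : l ≤ lO m) {qJ qI qI2 : ℚ}
    (hJ : jOQ m l ≤ qJ) (hI : i0Q (m + 3) l ≤ qI) (hI2 : i2Q (m + 3) l ≤ qI2)
    (h1 : ((qJ : ℚ) : ℝ) ≤ t) (h2 : ((qI : ℚ) : ℝ) ≤ ((10 : ℕ) : ℝ) * afmin * t)
    (h3 : (afmax - 1) * (2 * ((10 : ℕ) : ℝ) * ((qI2 : ℚ) : ℝ)) ≤ 2 * ((10 : ℕ) : ℝ) ^ 2 * t) :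
    OriginDomAlt 10 afmin afmax m l t := by
  have hl8 : l ≤ 8 := by
    revert hl
    interval_cases m <;> simp only [lO] <;> omega
  refine originDomAlt_of_printed (((srwJ_origin_le_jOQ hm hl).trans (castle hJ)).trans h1)
    (((srwI_origin_le_i0Q (by omega) (by omega)).trans (castle hI)).trans h2) (le_trans ?_ h3)
  exact mul_le_mul_of_nonneg_left
    (mul_le_mul_of_nonneg_left ((srwI_two_le_i2Q (by omega) (by omega)).trans (castle hI2)) (by positivity)) (by linarith)

/-- **`OriginDomAlt 10 α̲ ᾱ m l t`, corrected branch**: from the same reads and `H1SlotD80.env 10 qJ qI (2·10·qI2) α̲ ᾱ 1 2 ≤ t`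
(`0 < α̲`, `1 ≤ ᾱ`). [cite: FitznerVanDerHofstad2016NoBLE, §3.3.5 (3.61)–(3.62), (3.64) p. 1076; (3.30) p. 1070; (5.1) p. 1090] -/
theorem originDomAlt_d10_of_env (hα : 0 < afmin) (hᾱ : 1 ≤ afmax) {m l : ℕ} (hm : m ≤ 1) (hl : l ≤ lO m) {qJ qI qI2 : ℚ}
    (hJ : jOQ m l ≤ qJ) (hI : i0Q (m + 3) l ≤ qI) (hI2 : i2Q (m + 3) l ≤ qI2)
    (h : H1SlotD80.env ((10 : ℕ) : ℝ) ((qJ : ℚ) : ℝ) ((qI : ℚ) : ℝ) (2 * ((10 : ℕ) : ℝ) * ((qI2 : ℚ) : ℝ)) afmin afmax 1 2 ≤ t) :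
    OriginDomAlt 10 afmin afmax m l t := by
  have hl8 : l ≤ 8 := by
    revert hl
    interval_cases m <;> simp only [lO] <;> omega
  exact originDomAlt_of_env_majorants_le (by norm_num) hα hᾱ ((srwJ_origin_le_jOQ hm hl).trans (castle hJ))
    ((srwI_origin_le_i0Q (by omega) (by omega)).trans (castle hI)) ((srwI_two_le_i2Q (by omega) (by omega)).trans (castle hI2)) h

end Constructors

/-! ## §2b. All-ℚ closings: at a rational tuple `(α̲, ᾱ)` and a rational entry `q` every `IM`-side hypothesis is ONE kernel decision

`envQ` is the ℚ mirror of the corrected majorant `H1SlotD80.env 10 𝓙 I S α̲ ᾱ 1 2` of [NoBLE] (3.61)–(3.62); with it, and with print's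
branch and the `m = −1` pair rewritten over ℚ, each constructor of §2 takes hypotheses that `decide +kernel` settles at literal arguments. -/

section RationalClosings

/-- ℚ mirror of the corrected slot majorant `H1SlotD80.env d 𝓙 I S α̲ ᾱ 1 2 = max (𝓙/α̲ + (ᾱ−1) I/(d α̲²)) ((ᾱ−1) S/(2d² α̲²))` at `d = 10`.
[cite: FitznerVanDerHofstad2016NoBLE, §3.3.5 (3.61)–(3.62) p. 1076] -/
def envQ (J I S α amax : ℚ) : ℚ :=
  max (J / α ^ 1 + (amax - 1) * I / (10 * α ^ 2)) ((amax - 1) * S / (2 * 10 ^ 2 * α ^ 2))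

/-- `envQ` casts to `H1SlotD80.env 10 … 1 2`. [cite: FitznerVanDerHofstad2016NoBLE, §3.3.5 (3.61)–(3.62) p. 1076] -/
theorem cast_envQ (J I S α amax : ℚ) :
    ((envQ J I S α amax : ℚ) : ℝ) = H1SlotD80.env ((10 : ℕ) : ℝ) (J : ℝ) (I : ℝ) (S : ℝ) (α : ℝ) (amax : ℝ) 1 2 := by
  unfold envQ H1SlotD80.env
  push_cast
  all_goals ring_nf

variable {α amax q : ℚ} {m l : ℕ}

/-- `𝒳`-cell entry, corrected branch of (3.64), all-ℚ: `envQ (jXQ m l) (iN2Q (m+3) l) (sN2Q (m+3) l) α̲ ᾱ ≤ q` gives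
`CellDomAlt 10 α̲ ᾱ m l q`. [cite: FitznerVanDerHofstad2016NoBLE, §3.3.5 (3.61)–(3.62), (3.64) p. 1076] -/
theorem cellDomAlt_d10_of_envQ (hα : 0 < α) (hᾱ : 1 ≤ amax) (hm : m ≤ 1) (hl : l ≤ 7)
    (h : envQ (jXQ m l) (iN2Q (m + 3) l) (sN2Q (m + 3) l) α amax ≤ q) :
    CellDomAlt 10 (α : ℝ) (amax : ℝ) m l (q : ℝ) :=
  cellDomAlt_d10_of_env (by exact_mod_cast hα) (by exact_mod_cast hᾱ) hm hl le_rfl le_rfl le_rfl (by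
    have e := cast_envQ (jXQ m l) (iN2Q (m + 3) l) (sN2Q (m + 3) l) α amax
    push_cast at e ⊢
    rw [← e]
    exact_mod_cast h)

/-- `𝒳`-cell entry, print's branch of (3.64), all-ℚ: `𝓙 ≤ q`, `I ≤ 10 α̲ q`, `(ᾱ − 1) S ≤ 2·10² q` on the read functions give
`CellDomAlt 10 α̲ ᾱ m l q`. [cite: FitznerVanDerHofstad2016NoBLE, §3.3.5 (3.58), (3.60), (3.64) pp. 1074–1076] -/
theorem cellDomAlt_d10_of_printedQ (hᾱ : 1 ≤ amax) (hm : m ≤ 1) (hl : l ≤ 7) (h1 : jXQ m l ≤ q)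
    (h2 : iN2Q (m + 3) l ≤ 10 * α * q) (h3 : (amax - 1) * sN2Q (m + 3) l ≤ 2 * 10 ^ 2 * q) :
    CellDomAlt 10 (α : ℝ) (amax : ℝ) m l (q : ℝ) :=
  cellDomAlt_d10_of_printed (by exact_mod_cast hᾱ) hm hl le_rfl le_rfl le_rfl (by exact_mod_cast h1)
    (by exact_mod_cast h2) (by exact_mod_cast h3)

/-- Print's `m = −1` first inequality over `𝒳` at column `l + 1`, all-ℚ node form.
[cite: FitznerVanDerHofstad2016NoBLE, §3.3.5 (3.63)–(3.64) p. 1076] -/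
theorem imNegOne_fst_node_d10Q (hα : 0 < α) (hl : l ≤ 21)
    (h : iN2Q 1 (l + 1) + sN2Q 2 l / (2 * 10 ^ 2 * α) ≤ q) :
    srwINode2 10 1 (l + 1) + srwIShift2Node2 10 2 l / (2 * ((10 : ℕ) : ℝ) ^ 2 * (α : ℝ)) ≤ (q : ℝ) :=
  imNegOne_fst_node_d10 (by exact_mod_cast hα) hl le_rfl le_rfl (by exact_mod_cast h)

/-- Print's `m = −1` second inequality over `𝒳`, all-ℚ node form. [cite: FitznerVanDerHofstad2016NoBLE, §3.3.5 (3.63)–(3.64) p. 1076] -/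
theorem imNegOne_snd_node_d10Q (hl : l ≤ 22) (h : iN2Q 2 l ≤ 10 * α * q) :
    srwINode2 10 2 l ≤ ((10 : ℕ) : ℝ) * (α : ℝ) * (q : ℝ) :=
  imNegOne_snd_node_d10 hl le_rfl (by exact_mod_cast h)

/-- Cone-cell entry on the cone `v` of `Q`, corrected branch, all-ℚ. [cite: FitznerVanDerHofstad2016NoBLE, §3.3.5 (3.61)–(3.62), (3.64) p. 1076; Lemma 5.1 p. 1093] -/
theorem onDomAlt_cone_d10_of_envQ (v : Cn) (hm : m ≤ 1) (hl : l ≤ v.lJ m)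
    (h : envQ (jCQ v m l) (iCQ v (m + 3) l) (sCQ v (m + 3) l) α amax ≤ q) :
    OnDomAlt 10 (α : ℝ) (amax : ℝ) v.cone m l (q : ℝ) :=
  onDomAlt_cone_d10_of_env v hm hl le_rfl le_rfl le_rfl (by
    have e := cast_envQ (jCQ v m l) (iCQ v (m + 3) l) (sCQ v (m + 3) l) α amax
    push_cast at e ⊢
    rw [← e]
    exact_mod_cast h)

/-- Cone-cell entry on the cone `v` of `Q`, print's branch, all-ℚ. [cite: FitznerVanDerHofstad2016NoBLE, §3.3.5 (3.58), (3.60), (3.64) pp. 1074–1076; Lemma 5.1 p. 1093] -/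
theorem onDomAlt_cone_d10_of_printedQ (v : Cn) (hᾱ : 1 ≤ amax) (hm : m ≤ 1) (hl : l ≤ v.lJ m) (h1 : jCQ v m l ≤ q)
    (h2 : iCQ v (m + 3) l ≤ 10 * α * q) (h3 : (amax - 1) * sCQ v (m + 3) l ≤ 2 * 10 ^ 2 * q) :
    OnDomAlt 10 (α : ℝ) (amax : ℝ) v.cone m l (q : ℝ) :=
  onDomAlt_cone_d10_of_printed v (by exact_mod_cast hᾱ) hm hl le_rfl le_rfl le_rfl (by exact_mod_cast h1)
    (by exact_mod_cast h2) (by exact_mod_cast h3)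

/-- Print's `m = −1` first inequality on the cone `v` at column `l + 1`, all-ℚ. [cite: FitznerVanDerHofstad2016NoBLE, §3.3.5 (3.63)–(3.64) p. 1076; Lemma 5.1 p. 1093] -/
theorem imNegOne_fst_cone_d10Q (v : Cn) (hα : 0 < α) (hl : l ≤ 21)
    (h : iCQ v 1 (l + 1) + sCQ v 2 l / (2 * 10 ^ 2 * α) ≤ q) :
    ∀ x ∈ v.cone, srwI 10 1 (l + 1) x + srwIShift2 10 2 l x / (2 * ((10 : ℕ) : ℝ) ^ 2 * (α : ℝ)) ≤ (q : ℝ) :=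
  imNegOne_fst_cone_d10 v (by exact_mod_cast hα) hl le_rfl le_rfl (by exact_mod_cast h)

/-- Print's `m = −1` second inequality on the cone `v`, all-ℚ. [cite: FitznerVanDerHofstad2016NoBLE, §3.3.5 (3.63)–(3.64) p. 1076; Lemma 5.1 p. 1093] -/
theorem imNegOne_snd_cone_d10Q (v : Cn) (hl : l ≤ 22) (h : iCQ v 2 l ≤ 10 * α * q) :
    ∀ x ∈ v.cone, srwI 10 2 l x ≤ ((10 : ℕ) : ℝ) * (α : ℝ) * (q : ℝ) :=
  imNegOne_snd_cone_d10 v hl le_rfl (by exact_mod_cast h)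

/-- Origin-cell entry, corrected branch, all-ℚ (with the symmetrised shift bound `S ≤ 2·10·I(2e₁)` of (3.30)).
[cite: FitznerVanDerHofstad2016NoBLE, §3.3.5 (3.61)–(3.62), (3.64) p. 1076; (3.30) p. 1070] -/
theorem originDomAlt_d10_of_envQ (hα : 0 < α) (hᾱ : 1 ≤ amax) (hm : m ≤ 1) (hl : l ≤ lO m)
    (h : envQ (jOQ m l) (i0Q (m + 3) l) (2 * 10 * i2Q (m + 3) l) α amax ≤ q) :
    OriginDomAlt 10 (α : ℝ) (amax : ℝ) m l (q : ℝ) :=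
  originDomAlt_d10_of_env (by exact_mod_cast hα) (by exact_mod_cast hᾱ) hm hl le_rfl le_rfl le_rfl (by
    have e := cast_envQ (jOQ m l) (i0Q (m + 3) l) (2 * 10 * i2Q (m + 3) l) α amax
    push_cast at e ⊢
    rw [← e]
    exact_mod_cast h)

/-- Origin-cell entry, print's branch, all-ℚ. [cite: FitznerVanDerHofstad2016NoBLE, §3.3.5 (3.58), (3.60), (3.64) pp. 1074–1076; (3.30) p. 1070] -/
theorem originDomAlt_d10_of_printedQ (hᾱ : 1 ≤ amax) (hm : m ≤ 1) (hl : l ≤ lO m) (h1 : jOQ m l ≤ q)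
    (h2 : i0Q (m + 3) l ≤ 10 * α * q) (h3 : (amax - 1) * (2 * 10 * i2Q (m + 3) l) ≤ 2 * 10 ^ 2 * q) :
    OriginDomAlt 10 (α : ℝ) (amax : ℝ) m l (q : ℝ) :=
  originDomAlt_d10_of_printed (by exact_mod_cast hᾱ) hm hl le_rfl le_rfl le_rfl (by exact_mod_cast h1)
    (by exact_mod_cast h2) (by exact_mod_cast h3)

end RationalClosings

/-! ### §3  The per-cone reading of a `Q`-cell, glued back to the `h0Q` / `h1Q` shape -/

/-- **A `Q`-cell bound from its three cone bounds** (`n`, `l` arbitrary): the shape `∀ x, 3 ≤ Σ_j |x_j| → boundHD75 (srwTrueAlt 10 α̲ ᾱ) n l x a ≤ b`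
of the hypotheses `h0Q` / `h1Q` of `nobleWeightedDiagramBoundAt_of_witness_srwTrueAlt_smallX` from the per-cone cell bounds supplied by
`CellSupD10.f3cellD10_{zero,one}_on_le (C := Cn.cone v)` (`Cn.cone_subset_Q10 v`) with the `IM` side from §2.
[cite: FitznerVanDerHofstad2016NoBLE, §3.3.5 (3.87) p. 1079; §5.1 p. 1093] -/
theorem boundHD75_Q_le_of_cones {afmin afmax : ℝ} {n l : ℕ} {a : Args} {b : ℝ}
    (h3 : ∀ x ∈ Cn.cone .v3, boundHD75 (srwTrueAlt 10 afmin afmax) n l x a ≤ b)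
    (h21 : ∀ x ∈ Cn.cone .v21, boundHD75 (srwTrueAlt 10 afmin afmax) n l x a ≤ b)
    (h111 : ∀ x ∈ Cn.cone .v111, boundHD75 (srwTrueAlt 10 afmin afmax) n l x a ≤ b) :
    ∀ x : Fin 10 → ℤ, 3 ≤ ∑ j, |x j| → boundHD75 (srwTrueAlt 10 afmin afmax) n l x a ≤ b :=
  boundHD75_srwTrueAlt_three_le_of_absCones (by norm_num) h3 h21 h111

end CellImD10

end Literature.Probability.FitznerVanDerHofstad2017
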